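import Literature.Geometry.Lorentzian.CoordMomentumTaylor
import Literature.Geometry.Lorentzian.KerrObstructionOuterLayer
import HarnessLib

/-!
# The nonlinear remainder of Li–Mei's obstruction is quadratic

Support file (all results proved; no named facts) for the named fact `LiMei.interiorKerrGluing`
(`InteriorKerrGluing.lean`; J. Li, H. Mei, *A construction of collapsing spacetimes in vacuum*,
Comm. Math. Phys. 378 (2020) = arXiv:2005.01249, Prop. 4.1), Step S5 of the architecture recorded
in `InteriorKerrGluingReduction.lean`. Li–Mei (p. 25): the obstruction
`𝓘_X = ∫ √g₀ χ M(D̃ + (h,ω))(X)` equals its linear part `𝓛_X` (packaged in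
`KerrObstructionLinearPackage.lean`) **plus `O(ε²)`**. Here is the `O(ε²)`: with the pointwise
uniform Taylor remainder of the momentum constraint in the first jets
(`IsMetricOn.exists_abs_momFn_sub_linMomFn_le`, `CoordMomentumTaylor.lean`) and `M(G₀,K₀) = 0`
(`momFn_zero_spin_eq_zero`):

* `MetricCoord.momFn_smul_arg`, `MetricCoord.linMomFn_smul_arg` — `M` and `DM` are homogeneous in
  the vector argument (to handle the rotation fields `ξ × y`, of norm `≤ s₂` on the shell);
* `LiMei.isCompact_normShell`, `LiMei.volume_normShell_lt_top` — the closed shell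
  `{s₁ ≤ ‖y‖ ≤ s₂}`;
* **`LiMei.exists_abs_integral_nonlinear_time_le`** — there are `r > 0`, `C ≥ 0` such that for
  all smooth symmetric `(γ, κ)` on `{1 < ‖y‖}` whose first jets are bounded by `η ≤ r` on the shell
  `{s₁ ≤ ‖y‖ ≤ s₂} ⊇ supp χ₀(‖·‖)` (`|χ₀| ≤ 1`):
  `|∫ √g₀ χ₀(‖y‖) [M(G₀+γ, K₀+κ)(y)(∂_t♭) − DM_{(G₀,K₀)}(γ,κ)(y)(∂_t♭)] dy| ≤ C η²`
  (`∂_t♭ = dirVec`);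
* **`LiMei.exists_abs_integral_nonlinear_rot_le`** — the same with the rotation fields
  `crossCLM ξ`, `‖ξ‖ ≤ 1`.

For the deformed glued datum `(γ, κ) = D̃(p) + (h, ω) − (G₀, K₀)` one has `η = O(ε)` on
`‖p‖ ≤ C₀ε` (closeness of `D` to the Schwarzschild cylinder, of the Kerr family to it, and of the
Corvino–Schoen correction), which is Li–Mei's `O(ε²)`.

## References

* J. Li, H. Mei, arXiv:2005.01249, §4, proof of Prop. 4.1, p. 25. [LiMei2020]
* R. Bartnik, J. Isenberg, *The constraint equations*, Birkhäuser 2004, §2, (2.2).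
  [BartnikIsenberg2004]
-/

noncomputable section

set_option maxSynthPendingDepth 3

open Set Filter Function Metric MeasureTheory ContinuousLinearMap Module
open scoped Topology RealInnerProductSpace Real Manifold ContDiff

namespace Literature.Geometry.Lorentzian

/-! ### Homogeneity of `M` and `DM` in the vector argument -/

namespace MetricCoord

variable {E : Type*} [NormedAddCommGroup E] [NormedSpace ℝ E] {ι : Type*} [Fintype ι]
  [FiniteDimensional ℝ E] (b : Basis ι ℝ E) (G K γ κ : E → E →L[ℝ] E →L[ℝ] ℝ)

/-- `M(G,K)(x)(c Z) = c · M(G,K)(x)(Z)`. [cite: BartnikIsenberg2004, (2.2)] -/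
theorem momFn_smul_arg (x : E) (c : ℝ) (Z : E) :
    momFn b G K x (c • Z) = c * momFn b G K x Z := by
  rw [momFn_eq, momFn_eq, mul_sub, Finset.mul_sum, map_smul, smul_eq_mul]
  congr 1
  refine Finset.sum_congr rfl fun k _ ↦ ?_
  rw [Finset.mul_sum]
  refine Finset.sum_congr rfl fun l _ ↦ ?_
  rw [map_smul, smul_eq_mul]
  ring

/-- `DM_{(G,K)}(γ,κ)(x)(c Z) = c · DM_{(G,K)}(γ,κ)(x)(Z)`. [cite: BartnikIsenberg2004, (2.2)] -/
theorem linMomFn_smul_arg (x : E) (c : ℝ) (Z : E) :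
    linMomFn b G K γ κ x (c • Z) = c * linMomFn b G K γ κ x Z := by
  rw [linMomFn_eq, linMomFn_eq, mul_sub, Finset.mul_sum, map_smul, smul_eq_mul]
  congr 1
  refine Finset.sum_congr rfl fun k _ ↦ ?_
  rw [Finset.mul_sum]
  refine Finset.sum_congr rfl fun l _ ↦ ?_
  simp only [map_smul, smul_eq_mul]
  ring

end MetricCoord

namespace LiMei

open MetricCoord

attribute [local instance] instNormedAddCommGroupBilinE3 instNormedSpaceBilinE3

/-! ### The closed shell -/

/-- The closed shell `{s₁ ≤ ‖y‖ ≤ s₂}`. [folklore] -/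
def normShell (s₁ s₂ : ℝ) : Set E3 := {y : E3 | s₁ ≤ ‖y‖ ∧ ‖y‖ ≤ s₂}

/-- Membership in the closed shell. [folklore] -/
theorem mem_normShell {s₁ s₂ : ℝ} {y : E3} : y ∈ normShell s₁ s₂ ↔ s₁ ≤ ‖y‖ ∧ ‖y‖ ≤ s₂ := Iff.rfl

/-- The closed shell is compact. [folklore] -/
theorem isCompact_normShell (s₁ s₂ : ℝ) : IsCompact (normShell s₁ s₂) := by
  refine Metric.isCompact_of_isClosed_isBounded ?_ ?_
  · exact (isClosed_le continuous_const continuous_norm).inter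
      (isClosed_le continuous_norm continuous_const)
  · exact (isBounded_closedBall (x := (0 : E3)) (r := s₂)).subset fun y hy ↦
      mem_closedBall_zero_iff.2 hy.2

/-- The closed shell has finite volume. [folklore] -/
theorem volume_normShell_lt_top (s₁ s₂ : ℝ) : volume (normShell s₁ s₂) < ⊤ :=
  (isCompact_normShell s₁ s₂).measure_lt_top

/-- The closed shell `{s₁ ≤ ‖y‖ ≤ s₂}`, `1 < s₁`, lies in the chart domain `{1 < ‖y‖}`. [folklore] -/
theorem normShell_subset {s₁ s₂ : ℝ} (hs₁ : 1 < s₁) : normShell s₁ s₂ ⊆ {y : E3 | 1 < ‖y‖} :=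
  fun _ hy ↦ lt_of_lt_of_le hs₁ hy.1

/-! ### The nonlinear remainder -/

section Nonlinear

variable [Kerr.Facts] {M r₀ : ℝ}

/-- **Pointwise bound of the nonlinear integrand** on the shell: with the constants of
`IsMetricOn.exists_abs_momFn_sub_linMomFn_le` for the Schwarzschild cylinder on the closed shell,
`|√g₀(y) χ₀(‖y‖) (M(G₀+γ,K₀+κ)(y)(Z) − DM(γ,κ)(y)(Z))| ≤ √A r₀² C ρ ‖J(γ,κ)(y)‖²` for `‖Z‖ ≤ ρ`,
`1 ≤ ρ` (homogeneity in `Z`; `M(G₀,K₀) = 0`; `√g₀ = √A r₀²/‖y‖²`, `|χ₀| ≤ 1`). [cite: LiMei2020, proof of Prop. 4.1, p. 25] -/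
theorem abs_nonlinearIntegrand_le (hr₀ : 0 < r₀) (h2M : r₀ < 2 * M) (τ₀ : ℝ) (R₀ : E3 →ₗᵢ[ℝ] E3)
    {s₁ s₂ : ℝ} (hs₁ : 1 < s₁) {χ₀ : ℝ → ℝ} (hχb : ∀ r, |χ₀ r| ≤ 1) {r C : ℝ}
    (hT : ∀ γ κ : E3 → E3 →L[ℝ] E3 →L[ℝ] ℝ,
      ContDiffOn ℝ ∞ γ {y : E3 | 1 < ‖y‖} → (∀ y ∈ {y : E3 | 1 < ‖y‖}, ∀ v w, γ y v w = γ y w v) →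
      ContDiffOn ℝ ∞ κ {y : E3 | 1 < ‖y‖} →
      ∀ y ∈ normShell s₁ s₂, ‖jetAt γ κ y‖ ≤ r → ∀ Z : E3, ‖Z‖ ≤ 1 →
        |momFn (EuclideanSpace.basisFun (Fin 3) ℝ).toBasis (cylH M 0 r₀ τ₀ R₀ + γ)
              (cylK M 0 hr₀ τ₀ R₀ + κ) y Z -
            momFn (EuclideanSpace.basisFun (Fin 3) ℝ).toBasis (cylH M 0 r₀ τ₀ R₀)
              (cylK M 0 hr₀ τ₀ R₀) y Z -
            linMomFn (EuclideanSpace.basisFun (Fin 3) ℝ).toBasis (cylH M 0 r₀ τ₀ R₀)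
              (cylK M 0 hr₀ τ₀ R₀) γ κ y Z| ≤ C * ‖jetAt γ κ y‖ ^ 2)
    {γ κ : E3 → E3 →L[ℝ] E3 →L[ℝ] ℝ} (hγ : ContDiffOn ℝ ∞ γ {y : E3 | 1 < ‖y‖})
    (hγs : ∀ y ∈ {y : E3 | 1 < ‖y‖}, ∀ v w, γ y v w = γ y w v)
    (hκ : ContDiffOn ℝ ∞ κ {y : E3 | 1 < ‖y‖}) {y : E3} (hy : y ∈ normShell s₁ s₂)
    (hjet : ‖jetAt γ κ y‖ ≤ r) {ρ : ℝ} (hρ : 1 ≤ ρ) {Z : E3} (hZ : ‖Z‖ ≤ ρ) :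
    |sqrtDetGram (cylH M 0 r₀ τ₀ R₀) (EuclideanSpace.basisFun (Fin 3) ℝ).toBasis y *
        (χ₀ ‖y‖ * (momFn (EuclideanSpace.basisFun (Fin 3) ℝ).toBasis (cylH M 0 r₀ τ₀ R₀ + γ)
            (cylK M 0 hr₀ τ₀ R₀ + κ) y Z -
          linMomFn (EuclideanSpace.basisFun (Fin 3) ℝ).toBasis (cylH M 0 r₀ τ₀ R₀)
            (cylK M 0 hr₀ τ₀ R₀) γ κ y Z))| ≤
      Real.sqrt (2 * M / r₀ - 1) * r₀ ^ 2 * C * ρ * ‖jetAt γ κ y‖ ^ 2 := by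
  set b := (EuclideanSpace.basisFun (Fin 3) ℝ).toBasis with hb
  have hy1 : 1 < ‖y‖ := normShell_subset hs₁ hy
  have hρ0 : 0 < ρ := lt_of_lt_of_le one_pos hρ
  -- homogeneity: `Z = ρ • Z'` with `‖Z'‖ ≤ 1`
  set Z' : E3 := ρ⁻¹ • Z with hZ'
  have hZ'1 : ‖Z'‖ ≤ 1 := by
    rw [hZ', norm_smul, norm_inv, Real.norm_eq_abs, abs_of_pos hρ0]
    exact (inv_mul_le_iff₀ hρ0).2 (by simpa using hZ)
  have hZeq : Z = ρ • Z' := by rw [hZ', smul_inv_smul₀ hρ0.ne']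
  have hdiff : momFn b (cylH M 0 r₀ τ₀ R₀ + γ) (cylK M 0 hr₀ τ₀ R₀ + κ) y Z -
      linMomFn b (cylH M 0 r₀ τ₀ R₀) (cylK M 0 hr₀ τ₀ R₀) γ κ y Z =
      ρ * (momFn b (cylH M 0 r₀ τ₀ R₀ + γ) (cylK M 0 hr₀ τ₀ R₀ + κ) y Z' -
        momFn b (cylH M 0 r₀ τ₀ R₀) (cylK M 0 hr₀ τ₀ R₀) y Z' -
        linMomFn b (cylH M 0 r₀ τ₀ R₀) (cylK M 0 hr₀ τ₀ R₀) γ κ y Z') := by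
    rw [momFn_zero_spin_eq_zero b hr₀ h2M τ₀ R₀ hy1 Z', hZeq, momFn_smul_arg, linMomFn_smul_arg]
    ring
  have hpt := hT γ κ hγ hγs hκ y hy hjet Z' hZ'1
  have hsq : |sqrtDetGram (cylH M 0 r₀ τ₀ R₀) b y| ≤ Real.sqrt (2 * M / r₀ - 1) * r₀ ^ 2 := by
    rw [hb, sqrtDetGram_cylH_zero_spin hr₀ h2M τ₀ R₀ hy1, abs_of_nonneg (by positivity)]
    refine div_le_self (by positivity) ?_
    nlinarith
  rw [hdiff, abs_mul, abs_mul, abs_mul, abs_of_pos hρ0]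
  have hA : 0 ≤ Real.sqrt (2 * M / r₀ - 1) * r₀ ^ 2 := by positivity
  calc |sqrtDetGram (cylH M 0 r₀ τ₀ R₀) b y| * (|χ₀ ‖y‖| * (ρ *
        |momFn b (cylH M 0 r₀ τ₀ R₀ + γ) (cylK M 0 hr₀ τ₀ R₀ + κ) y Z' -
          momFn b (cylH M 0 r₀ τ₀ R₀) (cylK M 0 hr₀ τ₀ R₀) y Z' -
          linMomFn b (cylH M 0 r₀ τ₀ R₀) (cylK M 0 hr₀ τ₀ R₀) γ κ y Z'|))
      ≤ (Real.sqrt (2 * M / r₀ - 1) * r₀ ^ 2) * (1 * (ρ * (C * ‖jetAt γ κ y‖ ^ 2))) := by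
        gcongr
        · exact hχb _
    _ = Real.sqrt (2 * M / r₀ - 1) * r₀ ^ 2 * C * ρ * ‖jetAt γ κ y‖ ^ 2 := by ring

/-- **The nonlinear remainder of the `∂_t`-obstruction is quadratic in the first jets of the
perturbation.** With `G₀, K₀` the Schwarzschild cylinder, `χ₀` any profile with `|χ₀| ≤ 1`
vanishing off `[s₁, s₂]` (`1 < s₁`): there are `r > 0`, `C ≥ 0` such that for all smooth
symmetric `(γ, κ)` on `{1 < ‖y‖}` and all `0 ≤ η ≤ r` bounding `‖J(γ,κ)‖` on the shell,
`|∫ √g₀ χ₀(‖y‖) (M(G₀+γ,K₀+κ)(y)(∂_t♭) − DM_{(G₀,K₀)}(γ,κ)(y)(∂_t♭)) dy| ≤ C η²`.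
[cite: LiMei2020, proof of Prop. 4.1, p. 25] -/
theorem exists_abs_integral_nonlinear_time_le (hr₀ : 0 < r₀) (h2M : r₀ < 2 * M) (τ₀ : ℝ)
    (R₀ : E3 →ₗᵢ[ℝ] E3) {s₁ s₂ : ℝ} (hs₁ : 1 < s₁) {χ₀ : ℝ → ℝ} (hχb : ∀ r, |χ₀ r| ≤ 1)
    (hχ0 : ∀ r, χ₀ r ≠ 0 → s₁ ≤ |r| ∧ |r| ≤ s₂) :
    ∃ r C : ℝ, 0 < r ∧ 0 ≤ C ∧ ∀ γ κ : E3 → E3 →L[ℝ] E3 →L[ℝ] ℝ,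
      ContDiffOn ℝ ∞ γ {y : E3 | 1 < ‖y‖} → (∀ y ∈ {y : E3 | 1 < ‖y‖}, ∀ v w, γ y v w = γ y w v) →
      ContDiffOn ℝ ∞ κ {y : E3 | 1 < ‖y‖} →
      ∀ η : ℝ, 0 ≤ η → η ≤ r → (∀ y ∈ normShell s₁ s₂, ‖jetAt γ κ y‖ ≤ η) →
        |∫ y, sqrtDetGram (cylH M 0 r₀ τ₀ R₀) (EuclideanSpace.basisFun (Fin 3) ℝ).toBasis y *
            (χ₀ ‖y‖ * (momFn (EuclideanSpace.basisFun (Fin 3) ℝ).toBasis (cylH M 0 r₀ τ₀ R₀ + γ)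
                (cylK M 0 hr₀ τ₀ R₀ + κ) y (dirVec y) -
              linMomFn (EuclideanSpace.basisFun (Fin 3) ℝ).toBasis (cylH M 0 r₀ τ₀ R₀)
                (cylK M 0 hr₀ τ₀ R₀) γ κ y (dirVec y)))| ≤ C * η ^ 2 := by
  set b := (EuclideanSpace.basisFun (Fin 3) ℝ).toBasis with hb
  have hG := isMetricOn_cylH_zero_spin hr₀ h2M τ₀ R₀
  have hK : ContDiffOn ℝ ∞ (cylK M 0 hr₀ τ₀ R₀) {y : E3 | 1 < ‖y‖} :=
    (contDiff_cylK_zero_spin hr₀ h2M τ₀ R₀).contDiffOn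
  obtain ⟨r, C, hr, hC, hT⟩ := hG.exists_abs_momFn_sub_linMomFn_le b hK (isCompact_normShell s₁ s₂)
    (normShell_subset hs₁)
  set A := Real.sqrt (2 * M / r₀ - 1) * r₀ ^ 2 with hA
  have hvol : 0 ≤ volume.real (normShell s₁ s₂) := measureReal_nonneg
  refine ⟨r, A * C * volume.real (normShell s₁ s₂), hr, by positivity,
    fun γ κ hγ hγs hκ η hη0 hηr hjet ↦ ?_⟩
  have hzero : ∀ y, y ∉ normShell s₁ s₂ →
      sqrtDetGram (cylH M 0 r₀ τ₀ R₀) b y * (χ₀ ‖y‖ *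
        (momFn b (cylH M 0 r₀ τ₀ R₀ + γ) (cylK M 0 hr₀ τ₀ R₀ + κ) y (dirVec y) -
          linMomFn b (cylH M 0 r₀ τ₀ R₀) (cylK M 0 hr₀ τ₀ R₀) γ κ y (dirVec y))) = 0 := by
    intro y hy
    have hχ : χ₀ ‖y‖ = 0 := by
      by_contra h
      have h' := hχ0 _ h
      rw [abs_norm] at h'
      exact hy h'
    rw [hχ, zero_mul, mul_zero]
  rw [← setIntegral_eq_integral_of_forall_compl_eq_zero hzero]
  have hbound : ∀ y ∈ normShell s₁ s₂,
      ‖sqrtDetGram (cylH M 0 r₀ τ₀ R₀) b y * (χ₀ ‖y‖ *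
        (momFn b (cylH M 0 r₀ τ₀ R₀ + γ) (cylK M 0 hr₀ τ₀ R₀ + κ) y (dirVec y) -
          linMomFn b (cylH M 0 r₀ τ₀ R₀) (cylK M 0 hr₀ τ₀ R₀) γ κ y (dirVec y)))‖ ≤
        A * C * η ^ 2 := by
    intro y hy
    rw [Real.norm_eq_abs]
    have hdir : ‖dirVec y‖ ≤ 1 := norm_unitDir_le_one y
    refine (abs_nonlinearIntegrand_le hr₀ h2M τ₀ R₀ hs₁ hχb hT hγ hγs hκ hy
      ((hjet y hy).trans hηr) le_rfl hdir).trans ?_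
    rw [mul_one]
    have hsq : ‖jetAt γ κ y‖ ^ 2 ≤ η ^ 2 := pow_le_pow_left₀ (norm_nonneg _) (hjet y hy) 2
    have hA0 : 0 ≤ A := by positivity
    nlinarith [mul_nonneg hA0 hC]
  refine (norm_setIntegral_le_of_norm_le_const (volume_normShell_lt_top s₁ s₂) hbound).trans
    (le_of_eq ?_) |> fun h ↦ by rwa [Real.norm_eq_abs] at h
  ring

/-- **The nonlinear remainder of the `Ω_ξ`-obstructions is quadratic in the first jets of the
perturbation** (`‖ξ‖ ≤ 1`, rotation field `crossCLM ξ y = ξ × y`, of norm `≤ s₂` on the shell).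
[cite: LiMei2020, proof of Prop. 4.1, p. 25] -/
theorem exists_abs_integral_nonlinear_rot_le (hr₀ : 0 < r₀) (h2M : r₀ < 2 * M) (τ₀ : ℝ)
    (R₀ : E3 →ₗᵢ[ℝ] E3) {s₁ s₂ : ℝ} (hs₁ : 1 < s₁) {χ₀ : ℝ → ℝ} (hχb : ∀ r, |χ₀ r| ≤ 1)
    (hχ0 : ∀ r, χ₀ r ≠ 0 → s₁ ≤ |r| ∧ |r| ≤ s₂) :
    ∃ r C : ℝ, 0 < r ∧ 0 ≤ C ∧ ∀ γ κ : E3 → E3 →L[ℝ] E3 →L[ℝ] ℝ,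
      ContDiffOn ℝ ∞ γ {y : E3 | 1 < ‖y‖} → (∀ y ∈ {y : E3 | 1 < ‖y‖}, ∀ v w, γ y v w = γ y w v) →
      ContDiffOn ℝ ∞ κ {y : E3 | 1 < ‖y‖} →
      ∀ η : ℝ, 0 ≤ η → η ≤ r → (∀ y ∈ normShell s₁ s₂, ‖jetAt γ κ y‖ ≤ η) → ∀ ξ : E3, ‖ξ‖ ≤ 1 →
        |∫ y, sqrtDetGram (cylH M 0 r₀ τ₀ R₀) (EuclideanSpace.basisFun (Fin 3) ℝ).toBasis y *
            (χ₀ ‖y‖ * (momFn (EuclideanSpace.basisFun (Fin 3) ℝ).toBasis (cylH M 0 r₀ τ₀ R₀ + γ)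
                (cylK M 0 hr₀ τ₀ R₀ + κ) y (crossCLM ξ y) -
              linMomFn (EuclideanSpace.basisFun (Fin 3) ℝ).toBasis (cylH M 0 r₀ τ₀ R₀)
                (cylK M 0 hr₀ τ₀ R₀) γ κ y (crossCLM ξ y)))| ≤ C * η ^ 2 := by
  set b := (EuclideanSpace.basisFun (Fin 3) ℝ).toBasis with hb
  have hG := isMetricOn_cylH_zero_spin hr₀ h2M τ₀ R₀
  have hK : ContDiffOn ℝ ∞ (cylK M 0 hr₀ τ₀ R₀) {y : E3 | 1 < ‖y‖} :=
    (contDiff_cylK_zero_spin hr₀ h2M τ₀ R₀).contDiffOn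
  obtain ⟨r, C, hr, hC, hT⟩ := hG.exists_abs_momFn_sub_linMomFn_le b hK (isCompact_normShell s₁ s₂)
    (normShell_subset hs₁)
  set A := Real.sqrt (2 * M / r₀ - 1) * r₀ ^ 2 with hA
  have hs₂' : 1 ≤ max s₂ 1 := le_max_right _ _
  have hvol : 0 ≤ volume.real (normShell s₁ s₂) := measureReal_nonneg
  refine ⟨r, A * C * max s₂ 1 * volume.real (normShell s₁ s₂), hr, by positivity,
    fun γ κ hγ hγs hκ η hη0 hηr hjet ξ hξ ↦ ?_⟩
  have hzero : ∀ y, y ∉ normShell s₁ s₂ →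
      sqrtDetGram (cylH M 0 r₀ τ₀ R₀) b y * (χ₀ ‖y‖ *
        (momFn b (cylH M 0 r₀ τ₀ R₀ + γ) (cylK M 0 hr₀ τ₀ R₀ + κ) y (crossCLM ξ y) -
          linMomFn b (cylH M 0 r₀ τ₀ R₀) (cylK M 0 hr₀ τ₀ R₀) γ κ y (crossCLM ξ y))) = 0 := by
    intro y hy
    have hχ : χ₀ ‖y‖ = 0 := by
      by_contra h
      have h' := hχ0 _ h
      rw [abs_norm] at h'
      exact hy h'
    rw [hχ, zero_mul, mul_zero]
  rw [← setIntegral_eq_integral_of_forall_compl_eq_zero hzero]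
  have hbound : ∀ y ∈ normShell s₁ s₂,
      ‖sqrtDetGram (cylH M 0 r₀ τ₀ R₀) b y * (χ₀ ‖y‖ *
        (momFn b (cylH M 0 r₀ τ₀ R₀ + γ) (cylK M 0 hr₀ τ₀ R₀ + κ) y (crossCLM ξ y) -
          linMomFn b (cylH M 0 r₀ τ₀ R₀) (cylK M 0 hr₀ τ₀ R₀) γ κ y (crossCLM ξ y)))‖ ≤
        A * C * max s₂ 1 * η ^ 2 := by
    intro y hy
    rw [Real.norm_eq_abs]
    have hcross : ‖crossCLM ξ y‖ ≤ max s₂ 1 := by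
      rw [crossCLM_apply]
      refine (norm_crossVec_le ξ y).trans ?_
      calc ‖ξ‖ * ‖y‖ ≤ 1 * s₂ := mul_le_mul hξ hy.2 (norm_nonneg _) zero_le_one
        _ ≤ max s₂ 1 := by rw [one_mul]; exact le_max_left _ _
    refine (abs_nonlinearIntegrand_le hr₀ h2M τ₀ R₀ hs₁ hχb hT hγ hγs hκ hy
      ((hjet y hy).trans hηr) hs₂' hcross).trans ?_
    have hsq : ‖jetAt γ κ y‖ ^ 2 ≤ η ^ 2 := pow_le_pow_left₀ (norm_nonneg _) (hjet y hy) 2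
    have hA0 : 0 ≤ A := by positivity
    have h3 : 0 ≤ A * C * max s₂ 1 := by positivity
    nlinarith
  refine (norm_setIntegral_le_of_norm_le_const (volume_normShell_lt_top s₁ s₂) hbound).trans
    (le_of_eq ?_) |> fun h ↦ by rwa [Real.norm_eq_abs] at h
  ring

end Nonlinear

end LiMei

end Literature.Geometry.Lorentzian

end
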